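import Literature.Geometry.Riemannian.SphericalCylinderEntropyKernelCalculus
import Literature.Geometry.Riemannian.SphericalZonalHamiltonHarnack
import Literature.Analysis.SpecialFunctions.GegenbauerHeatHarnack
import HarnessLib

/-!
# Hamilton's matrix Harnack inequality for the typed kernel on `N = S⁴ × ℝ`

Topic `Literature/Geometry/Riemannian`; continuation of `SphericalCylinderEntropyKernelCalculus.lean`
(ambient first and second derivatives of the typed kernel
`k = cylKernel p τ = 𝔥(τ, ⟨·', p'⟩) · e^{-(z₅-p₅)²/4τ}` of route `SmoothPoincare4/CylinderEntropy`)
and of the tree's Li–Yau–Hamilton analysis of the zonal heat kernel of `S⁴`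
(`GegenbauerHeatHarnack.harnack_gegenbauerHeat_one`: Hamilton's matrix Harnack inequality in radial
form for the positive polynomial heat flows; `SphericalZonalHamiltonHarnack.zonal_pos`).  Proved here
(everything; no facts, no definitions):

* `deriv_gegen_eq_gegenbauerSumD`, `deriv_deriv_gegen_eq_gegenbauerSumDD`,
  `gegenbauerHeatDs_eq_partialSum`, `gegenbauerHeatDss_eq_partialSum` — the `s`-jets of the
  polynomial flows approximating `𝔥` are the partial sums of the term-wise derivative series of
  `SphericalCylinderEntropyHeatEquation.lean`;
* `zonal_matrixHarnack` — **Hamilton's matrix Harnack inequality for the zonal kernel of `S⁴`**,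
  both blocks, for the series itself: for `τ > 0`, `s ∈ [-1, 1]`,
  `(1 - s²)(𝔥_ss 𝔥 - 𝔥_s²) - s 𝔥_s 𝔥 + 𝔥²/(2τ) ≥ 0` (radial) and `-s 𝔥_s 𝔥 + 𝔥²/(2τ) ≥ 0`
  (spherical directions) — the limit `J → ∞`, `σ → 0`, `ε → 0` of `harnack_gegenbauerHeat_one`
  (in polar coordinates about `p'` the Hessian of the zonal function `𝔥(⟨·, p'⟩)` on `S⁴` is
  `diag(𝔥_θθ, cot θ 𝔥_θ, cot θ 𝔥_θ, cot θ 𝔥_θ)` with `𝔥_θθ = (1-s²)𝔥_ss - s𝔥_s`, `cot θ 𝔥_θ = -s 𝔥_s`);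
* `inner_tangent_sq_le` — `⟨v', p'⟩² ≤ (1 - ⟨z', p'⟩²) |v'|²` for `v' ⊥ z'`, `|z'| = |p'| = 1`;
* `harnackQuadratic_nonneg` — **Hamilton's Harnack quadratic form of the typed kernel along `N` is
  non-negative**: for `p, z ∈ N`, `τ > 0`, `v ∈ T_z N`,
  `D²k(v,v) - |v'|² Dk(n) - (Dk v)²/k + k |v|²/(2τ) ≥ 0` (`n = (z', 0)`; the first two terms are
  `Hess_N k(v, v)`).  By the kernel calculus this form is `(G/𝔥) [α² (𝔥_ss 𝔥 - 𝔥_s²) +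
  |v'|² (-s 𝔥_s 𝔥 + 𝔥²/(2τ))]` (`α = ⟨v', p'⟩`; the `ℝ`-block `G'' - G'²/G + G/(2τ)` of the product
  vanishes identically and the cross terms cancel), which is `≥ 0` by the two zonal inequalities and
  `α² ≤ (1 - s²)|v'|²`.  This is EXACTLY hypothesis `MatrixHarnack` of the reduction of stub
  `stub_hamiltonMonotonicity` (crux `CylinderRungTwo`): Hamilton's matrix Harnack estimate
  (Comm. Anal. Geom. 1 (1993) 113–126, Main Theorem: compact, parallel Ricci, `sec ≥ 0`) for
  `M = S⁴` and `f` the heat kernel, transported to the typed product kernel of `N`.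

## References
* R. S. Hamilton, *A matrix Harnack estimate for the heat equation*, Comm. Anal. Geom. 1 (1993),
  113–126, Main Theorem and Cor. 4.4; *Monotonicity formulas for parabolic flows on manifolds*,
  ibid. 127–137, §4.
* E. B. Davies, *Heat Kernels and Spectral Theory*, CUP 1989, Ch. 5.
-/

noncomputable section

open scoped BigOperators Topology ContDiff
open Filter Set Finset Literature.Geometry.Riemannian Literature.Analysis.SpecialFunctions
  Literature.Geometry.Riemannian.SphericalZonalKernelSeries

namespace Literature.Geometry.Riemannian.SphericalCylinderEntropy

/-! ### The jets of the approximating polynomial flows are the partial sums -/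

/-- `C_j' = D_j^{(3/2)}` (the tree's term-wise derivative sum). [folklore] -/
theorem deriv_gegen_eq_gegenbauerSumD (j : ℕ) (s : ℝ) :
    deriv (gegen j) s = gegenbauerSumD (((1 : ℕ) : ℝ) + 1 / 2) j s := by
  have h : gegen j = gegenbauerSum (((1 : ℕ) : ℝ) + 1 / 2) j := funext (gegen_eq_gegenbauerSum j)
  rw [h]
  exact (hasDerivAt_gegenbauerSum _ j s).deriv

/-- `C_j'' = DD_j^{(3/2)}`. [folklore] -/
theorem deriv_deriv_gegen_eq_gegenbauerSumDD (j : ℕ) (s : ℝ) :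
    deriv (deriv (gegen j)) s = gegenbauerSumDD (((1 : ℕ) : ℝ) + 1 / 2) j s := by
  have h : deriv (gegen j) = gegenbauerSumD (((1 : ℕ) : ℝ) + 1 / 2) j :=
    funext (deriv_gegen_eq_gegenbauerSumD j)
  rw [h]
  exact (hasDerivAt_gegenbauerSumD _ j s).deriv

/-- The weight bookkeeping `wt j (t + σ) = e^{-j(j+3)σ} (j+3/2)/(3/2) · e^{-j(j+3)t}`. [folklore] -/
theorem wt_add_eq (j : ℕ) (t σ : ℝ) :
    wt j (t + σ) = Real.exp (-((j : ℝ) * ((j : ℝ) + 2 * (1 : ℕ) + 1) * σ)) *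
      (((j : ℝ) + (((1 : ℕ) : ℝ) + 1 / 2)) / (((1 : ℕ) : ℝ) + 1 / 2)) *
      Real.exp (-((j : ℝ) * ((j : ℝ) + 2 * (1 : ℕ) + 1) * t)) := by
  rw [wt_eq]
  have h : Real.exp (-((j : ℝ) * ((j : ℝ) + 2 * (1 : ℕ) + 1) * (t + σ))) =
      Real.exp (-((j : ℝ) * ((j : ℝ) + 2 * (1 : ℕ) + 1) * σ)) *
        Real.exp (-((j : ℝ) * ((j : ℝ) + 2 * (1 : ℕ) + 1) * t)) := by
    rw [← Real.exp_add]; ring_nf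
  rw [h]; ring

/-- **The first `s`-jet of the approximating flow is the partial sum of the derivative series**:
with the coefficients `b` of `partialSum_zonal_add_eq_gegenbauerHeat`,
`∂_s V_J(s, t) = ∑_{j<J} wt j (t+σ) C_j'(s)` (the constant `ε` does not contribute). [folklore] -/
theorem gegenbauerHeatDs_eq_partialSum (σ t s ε : ℝ) (J : ℕ) :
    gegenbauerHeatDs 1 (fun j : ℕ => Real.exp (-((j : ℝ) * ((j : ℝ) + 2 * (1 : ℕ) + 1) * σ)) *
        (((j : ℝ) + (((1 : ℕ) : ℝ) + 1 / 2)) / (((1 : ℕ) : ℝ) + 1 / 2)) +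
          if j = 0 then ε else 0) J s t =
      ∑ j ∈ Finset.range J, wt j (t + σ) * deriv (gegen j) s := by
  unfold gegenbauerHeatDs
  refine Finset.sum_congr rfl fun j _ => ?_
  beta_reduce
  rw [deriv_gegen_eq_gegenbauerSumD, wt_add_eq]
  by_cases hj : j = 0
  · subst hj
    simp [gegenbauerSumD]
  · rw [if_neg hj, add_zero]

/-- **The second `s`-jet of the approximating flow is the partial sum of the second-derivative
series**: `∂_s² V_J(s, t) = ∑_{j<J} wt j (t+σ) C_j''(s)`. [folklore] -/
theorem gegenbauerHeatDss_eq_partialSum (σ t s ε : ℝ) (J : ℕ) :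
    gegenbauerHeatDss 1 (fun j : ℕ => Real.exp (-((j : ℝ) * ((j : ℝ) + 2 * (1 : ℕ) + 1) * σ)) *
        (((j : ℝ) + (((1 : ℕ) : ℝ) + 1 / 2)) / (((1 : ℕ) : ℝ) + 1 / 2)) +
          if j = 0 then ε else 0) J s t =
      ∑ j ∈ Finset.range J, wt j (t + σ) * deriv (deriv (gegen j)) s := by
  unfold gegenbauerHeatDss
  refine Finset.sum_congr rfl fun j _ => ?_
  beta_reduce
  rw [deriv_deriv_gegen_eq_gegenbauerSumDD, wt_add_eq]
  by_cases hj : j = 0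
  · subst hj
    simp [gegenbauerSumDD]
  · rw [if_neg hj, add_zero]

/-! ### Hamilton's matrix Harnack inequality for the zonal kernel of `S⁴` -/

/-- **The perturbed inequalities** (`J → ∞` in Hamilton's inequality for the positive polynomial
flows `V_J = ∑_{j<J} wt j (· + σ) C_j + ε`): for `0 < σ < τ`, `ε > 0`, `s ∈ [-1, 1]`,
`(1-s²)(𝔥_ss (𝔥+ε) - 𝔥_s²) - s 𝔥_s (𝔥+ε) + (𝔥+ε)²/(2(τ-σ)) ≥ 0` and
`-s 𝔥_s (𝔥+ε) + (𝔥+ε)²/(2(τ-σ)) ≥ 0` at scale `τ`. [cite: Hamilton1993Harnack, Main Theorem] -/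
theorem zonal_matrixHarnack_perturbed {τ σ ε : ℝ} (hσ : 0 < σ) (hστ : σ < τ) (hε : 0 < ε) {s : ℝ}
    (hs : s ∈ Icc (-1 : ℝ) 1) :
    0 ≤ (1 - s ^ 2) * (deriv (deriv (zonal τ)) s * (zonal τ s + ε) - deriv (zonal τ) s ^ 2)
          - s * (deriv (zonal τ) s * (zonal τ s + ε)) + (zonal τ s + ε) ^ 2 / (2 * (τ - σ)) ∧
      0 ≤ -s * (deriv (zonal τ) s * (zonal τ s + ε)) + (zonal τ s + ε) ^ 2 / (2 * (τ - σ)) := by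
  have hτ : 0 < τ := hσ.trans hστ
  have hT : 0 < τ - σ := sub_pos.2 hστ
  set b : ℕ → ℝ := fun j : ℕ => Real.exp (-((j : ℝ) * ((j : ℝ) + 2 * (1 : ℕ) + 1) * σ)) *
    (((j : ℝ) + (((1 : ℕ) : ℝ) + 1 / 2)) / (((1 : ℕ) : ℝ) + 1 / 2)) +
      if j = 0 then ε else 0 with hb
  -- the partial sums at scale `τ`
  set P0 : ℕ → ℝ := fun J => ∑ j ∈ Finset.range J, wt j τ * gegen j s + ε with hP0
  set P1 : ℕ → ℝ := fun J => ∑ j ∈ Finset.range J, wt j τ * deriv (gegen j) s with hP1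
  set P2 : ℕ → ℝ := fun J => ∑ j ∈ Finset.range J, wt j τ * deriv (deriv (gegen j)) s with hP2
  have hflow : ∀ (J : ℕ) (s' t : ℝ), 0 < J →
      gegenbauerHeat 1 b J s' t = ∑ j ∈ Finset.range J, wt j (t + σ) * gegen j s' + ε :=
    fun J s' t hJ => (partialSum_zonal_add_eq_gegenbauerHeat σ t s' ε hJ).symm
  have hid0 : ∀ J : ℕ, 0 < J → gegenbauerHeat 1 b J s (τ - σ) = P0 J := by
    intro J hJ; rw [hflow J s _ hJ, sub_add_cancel]
  have hid1 : ∀ J : ℕ, gegenbauerHeatDs 1 b J s (τ - σ) = P1 J := by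
    intro J; rw [hb, gegenbauerHeatDs_eq_partialSum, sub_add_cancel]
  have hid2 : ∀ J : ℕ, gegenbauerHeatDss 1 b J s (τ - σ) = P2 J := by
    intro J; rw [hb, gegenbauerHeatDss_eq_partialSum, sub_add_cancel]
  -- Hamilton's inequality for `J` large, multiplied through by `V_J² > 0`
  have hev : ∀ᶠ J : ℕ in atTop,
      (0 ≤ (1 - s ^ 2) * (P2 J * P0 J - P1 J ^ 2) - s * (P1 J * P0 J) + P0 J ^ 2 / (2 * (τ - σ))) ∧
        (0 ≤ -s * (P1 J * P0 J) + P0 J ^ 2 / (2 * (τ - σ))) := by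
    filter_upwards [eventually_partialSum_add_pos (T := τ) hσ hε, eventually_gt_atTop 0]
      with J hJ hJ0
    have hposflow : ∀ s' ∈ Icc (-1 : ℝ) 1, ∀ t ∈ Icc (0 : ℝ) (τ - σ), 0 < gegenbauerHeat 1 b J s' t := by
      intro s' hs' t ht
      rw [hflow J s' t hJ0]
      exact hJ s' hs' (t + σ) ⟨by linarith [ht.1], by linarith [ht.2]⟩
    have hH := harnack_gegenbauerHeat_one hposflow s hs (τ - σ) ⟨hT, le_rfl⟩
    rw [hid0 J hJ0, hid1, hid2] at hH
    have hP : 0 < P0 J := by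
      have h := hJ s hs τ ⟨hστ.le, le_rfl⟩
      simpa [hP0] using h
    have hPne : P0 J ≠ 0 := hP.ne'
    constructor
    · have h := mul_nonneg hH.1 (sq_nonneg (P0 J))
      calc (0 : ℝ) ≤ _ := h
        _ = _ := by field_simp
    · have h := mul_nonneg hH.2 (sq_nonneg (P0 J))
      calc (0 : ℝ) ≤ _ := h
        _ = _ := by field_simp
  -- the limits `J → ∞`
  have hlim0 : Tendsto P0 atTop (𝓝 (zonal τ s + ε)) := by
    have h := ((hasSum_zonal_real hτ s).tendsto_sum_nat).add_const ε
    simpa [hP0] using h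
  have hlim1 : Tendsto P1 atTop (𝓝 (deriv (zonal τ) s)) := by
    have h := (summable_wt_mul_deriv_gegen hτ s).hasSum.tendsto_sum_nat
    rw [congrFun (deriv_zonal_eq_tsum hτ) s]
    simpa [hP1] using h
  have hlim2 : Tendsto P2 atTop (𝓝 (deriv (deriv (zonal τ)) s)) := by
    have h := (summable_wt_mul_deriv_deriv_gegen hτ s).hasSum.tendsto_sum_nat
    rw [congrFun (deriv_deriv_zonal_eq_tsum hτ) s]
    simpa [hP2] using h
  have hlimR : Tendsto (fun J : ℕ => (1 - s ^ 2) * (P2 J * P0 J - P1 J ^ 2) - s * (P1 J * P0 J) +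
      P0 J ^ 2 / (2 * (τ - σ))) atTop
      (𝓝 ((1 - s ^ 2) * (deriv (deriv (zonal τ)) s * (zonal τ s + ε) - deriv (zonal τ) s ^ 2)
          - s * (deriv (zonal τ) s * (zonal τ s + ε)) + (zonal τ s + ε) ^ 2 / (2 * (τ - σ)))) :=
    ((((hlim2.mul hlim0).sub (hlim1.pow 2)).const_mul (1 - s ^ 2)).sub
      ((hlim1.mul hlim0).const_mul s)).add ((hlim0.pow 2).div_const (2 * (τ - σ)))
  have hlimT : Tendsto (fun J : ℕ => -s * (P1 J * P0 J) + P0 J ^ 2 / (2 * (τ - σ))) atTop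
      (𝓝 (-s * (deriv (zonal τ) s * (zonal τ s + ε)) + (zonal τ s + ε) ^ 2 / (2 * (τ - σ)))) :=
    ((hlim1.mul hlim0).const_mul (-s)).add ((hlim0.pow 2).div_const (2 * (τ - σ)))
  exact ⟨ge_of_tendsto hlimR (hev.mono fun J hJ => hJ.1), ge_of_tendsto hlimT (hev.mono fun J hJ => hJ.2)⟩

/-- **Hamilton's matrix Harnack inequality for the zonal heat kernel of `S⁴`** (both blocks, for the
series `𝔥 = zonal` itself): for `τ > 0` and `s ∈ [-1, 1]`,
`(1 - s²)(𝔥_ss 𝔥 - 𝔥_s²) - s 𝔥_s 𝔥 + 𝔥²/(2τ) ≥ 0` (the geodesic direction through the centre: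
`𝔥² (∂_θ² log 𝔥 + 1/(2τ))`) and `-s 𝔥_s 𝔥 + 𝔥²/(2τ) ≥ 0` (the three spherical directions
orthogonal to it: `𝔥² (cot θ ∂_θ log 𝔥 + 1/(2τ))`).  Limit `σ, ε → 0` of
`zonal_matrixHarnack_perturbed`. [cite: Hamilton1993Harnack, Main Theorem and Cor. 4.4] -/
theorem zonal_matrixHarnack {τ : ℝ} (hτ : 0 < τ) {s : ℝ} (hs : s ∈ Icc (-1 : ℝ) 1) :
    0 ≤ (1 - s ^ 2) * (deriv (deriv (zonal τ)) s * zonal τ s - deriv (zonal τ) s ^ 2)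
          - s * (deriv (zonal τ) s * zonal τ s) + zonal τ s ^ 2 / (2 * τ) ∧
      0 ≤ -s * (deriv (zonal τ) s * zonal τ s) + zonal τ s ^ 2 / (2 * τ) := by
  -- along `σ_n = ε_n = τ/(n+2) → 0`
  have hσn : ∀ n : ℕ, 0 < τ / ((n : ℝ) + 2) ∧ τ / ((n : ℝ) + 2) < τ := fun n =>
    ⟨by positivity, div_lt_self hτ (by linarith [(n.cast_nonneg : (0 : ℝ) ≤ n)])⟩
  have hstep := fun n : ℕ =>
    zonal_matrixHarnack_perturbed (hσn n).1 (hσn n).2 (hσn n).1 hs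
  have hδ : Tendsto (fun n : ℕ => τ / ((n : ℝ) + 2)) atTop (𝓝 0) :=
    tendsto_const_div_natCast_add_two τ
  have hH0 : Tendsto (fun n : ℕ => zonal τ s + τ / ((n : ℝ) + 2)) atTop (𝓝 (zonal τ s)) := by
    simpa using tendsto_const_nhds.add hδ
  have hden : Tendsto (fun n : ℕ => 2 * (τ - τ / ((n : ℝ) + 2))) atTop (𝓝 (2 * τ)) := by
    simpa using tendsto_const_nhds.mul (tendsto_const_nhds.sub hδ)
  have h2τ : (2 : ℝ) * τ ≠ 0 := by positivity
  have hsq : Tendsto (fun n : ℕ => (zonal τ s + τ / ((n : ℝ) + 2)) ^ 2 / (2 * (τ - τ / ((n : ℝ) + 2))))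
      atTop (𝓝 (zonal τ s ^ 2 / (2 * τ))) := (hH0.pow 2).div hden h2τ
  have hlimR : Tendsto (fun n : ℕ =>
      (1 - s ^ 2) * (deriv (deriv (zonal τ)) s * (zonal τ s + τ / ((n : ℝ) + 2)) - deriv (zonal τ) s ^ 2)
        - s * (deriv (zonal τ) s * (zonal τ s + τ / ((n : ℝ) + 2)))
        + (zonal τ s + τ / ((n : ℝ) + 2)) ^ 2 / (2 * (τ - τ / ((n : ℝ) + 2)))) atTop
      (𝓝 ((1 - s ^ 2) * (deriv (deriv (zonal τ)) s * zonal τ s - deriv (zonal τ) s ^ 2)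
        - s * (deriv (zonal τ) s * zonal τ s) + zonal τ s ^ 2 / (2 * τ))) :=
    ((((tendsto_const_nhds.mul hH0).sub tendsto_const_nhds).const_mul (1 - s ^ 2)).sub
      ((tendsto_const_nhds.mul hH0).const_mul s)).add hsq
  have hlimT : Tendsto (fun n : ℕ => -s * (deriv (zonal τ) s * (zonal τ s + τ / ((n : ℝ) + 2)))
        + (zonal τ s + τ / ((n : ℝ) + 2)) ^ 2 / (2 * (τ - τ / ((n : ℝ) + 2)))) atTop
      (𝓝 (-s * (deriv (zonal τ) s * zonal τ s) + zonal τ s ^ 2 / (2 * τ))) :=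
    ((tendsto_const_nhds.mul hH0).const_mul (-s)).add hsq
  exact ⟨ge_of_tendsto hlimR (Eventually.of_forall fun n => (hstep n).1),
    ge_of_tendsto hlimT (Eventually.of_forall fun n => (hstep n).2)⟩

/-! ### The Harnack quadratic form of the typed kernel along `N` -/

/-- **Cauchy–Schwarz on the tangent space of `S⁴`**: for unit `z', p'` and `v' ⊥ z'`,
`⟨v', p'⟩² ≤ (1 - ⟨z', p'⟩²) |v'|²` (`⟨v', p'⟩ = ⟨v', p' - s z'⟩`, `|p' - s z'|² = 1 - s²`). [folklore] -/
theorem inner_tangent_sq_le {p z v : EuclideanSpace ℝ (Fin 6)}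
    (hp : ∑ i : Fin 5, p (Fin.castSucc i) ^ 2 = 1) (hz : ∑ i : Fin 5, z (Fin.castSucc i) ^ 2 = 1)
    (hv : ∑ i : Fin 5, v (Fin.castSucc i) * z (Fin.castSucc i) = 0) :
    (∑ i : Fin 5, v (Fin.castSucc i) * p (Fin.castSucc i)) ^ 2 ≤
      (1 - (∑ i : Fin 5, z (Fin.castSucc i) * p (Fin.castSucc i)) ^ 2) *
        ∑ i : Fin 5, v (Fin.castSucc i) ^ 2 := by
  set s : ℝ := ∑ i : Fin 5, z (Fin.castSucc i) * p (Fin.castSucc i) with hsdef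
  clear_value s
  -- `⟨v', p' - s z'⟩ = ⟨v', p'⟩` and `|p' - s z'|² = 1 - s²`
  have h1 : ∑ i : Fin 5, v (Fin.castSucc i) * (p (Fin.castSucc i) - s * z (Fin.castSucc i)) =
      ∑ i : Fin 5, v (Fin.castSucc i) * p (Fin.castSucc i) := by
    have : ∑ i : Fin 5, v (Fin.castSucc i) * (p (Fin.castSucc i) - s * z (Fin.castSucc i)) =
        ∑ i : Fin 5, v (Fin.castSucc i) * p (Fin.castSucc i) -
          s * ∑ i : Fin 5, v (Fin.castSucc i) * z (Fin.castSucc i) := by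
      rw [Finset.mul_sum, ← Finset.sum_sub_distrib]
      exact Finset.sum_congr rfl fun i _ => by ring
    rw [this, hv, mul_zero, sub_zero]
  have h2 : ∑ i : Fin 5, (p (Fin.castSucc i) - s * z (Fin.castSucc i)) ^ 2 = 1 - s ^ 2 := by
    have : ∑ i : Fin 5, (p (Fin.castSucc i) - s * z (Fin.castSucc i)) ^ 2 =
        ∑ i : Fin 5, p (Fin.castSucc i) ^ 2 - 2 * s * ∑ i : Fin 5, z (Fin.castSucc i) * p (Fin.castSucc i)
          + s ^ 2 * ∑ i : Fin 5, z (Fin.castSucc i) ^ 2 := by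
      rw [Finset.mul_sum, Finset.mul_sum, ← Finset.sum_sub_distrib, ← Finset.sum_add_distrib]
      exact Finset.sum_congr rfl fun i _ => by ring
    rw [this, hp, hz, ← hsdef]; ring
  have hcs := Finset.sum_mul_sq_le_sq_mul_sq Finset.univ
    (fun i : Fin 5 => v (Fin.castSucc i)) (fun i : Fin 5 => p (Fin.castSucc i) - s * z (Fin.castSucc i))
  rw [h1, h2] at hcs
  linarith

/-- `‖v‖² = |v'|² + v₅²` on `ℝ⁶`. [folklore] -/
theorem norm_sq_eq_sum_add (v : EuclideanSpace ℝ (Fin 6)) :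
    ‖v‖ ^ 2 = ∑ i : Fin 5, v (Fin.castSucc i) ^ 2 + v 5 ^ 2 := by
  rw [EuclideanSpace.norm_sq_eq, Fin.sum_univ_castSucc]
  simp [five_eq_last]

/-- **Hamilton's matrix Harnack inequality for the typed kernel along `N`** (hypothesis
`MatrixHarnack` of the reduction of stub `stub_hamiltonMonotonicity`, crux `CylinderRungTwo`): for
`p, z ∈ N = S⁴ × ℝ`, `τ > 0` and `v` tangent to `N` at `z` (`v' ⊥ z'`), the Harnack quadratic form
`Q = D²k(v,v) - |v'|² Dk(n) - (Dk v)²/k + k ‖v‖²/(2τ)` of `k = cylKernel p τ` (`n = (z', 0)`; the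
first two terms are the Hessian of `N`) is non-negative.  By the kernel calculus
`Q = (G/𝔥) [α² (𝔥_ss 𝔥 - 𝔥_s²) + |v'|² (-s 𝔥_s 𝔥 + 𝔥²/(2τ))]`, `α = ⟨v', p'⟩`, `s = ⟨z', p'⟩`
(the `ℝ`-block of the product kernel vanishes identically), and this is `≥ 0` by
`zonal_matrixHarnack` and `α² ≤ (1-s²)|v'|²`. [cite: Hamilton1993Harnack, Main Theorem and Cor. 4.4] -/
theorem harnackQuadratic_nonneg (p : EuclideanSpace ℝ (Fin 6))
    (hp : ∑ i : Fin 5, p (Fin.castSucc i) ^ 2 = 1) {τ : ℝ} (hτ : 0 < τ)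
    (z : EuclideanSpace ℝ (Fin 6)) (hz : ∑ i : Fin 5, z (Fin.castSucc i) ^ 2 = 1)
    (v : EuclideanSpace ℝ (Fin 6)) (hv : ∑ i : Fin 5, v (Fin.castSucc i) * z (Fin.castSucc i) = 0) :
    0 ≤ iteratedFDeriv ℝ 2 (cylKernel p τ) z ![v, v]
        - (∑ i : Fin 5, v (Fin.castSucc i) ^ 2) *
            fderiv ℝ (cylKernel p τ) z (Literature.Geometry.Manifold.CylinderSlice.padL (truncL z))
        - (fderiv ℝ (cylKernel p τ) z v) ^ 2 / cylKernel p τ z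
        + cylKernel p τ z * ‖v‖ ^ 2 / (2 * τ) := by
  -- abbreviations
  set s : ℝ := ∑ i : Fin 5, z (Fin.castSucc i) * p (Fin.castSucc i) with hsdef
  set α : ℝ := ∑ i : Fin 5, v (Fin.castSucc i) * p (Fin.castSucc i) with hαdef
  set m : ℝ := ∑ i : Fin 5, v (Fin.castSucc i) ^ 2 with hmdef
  set G : ℝ := Real.exp (-((z 5 - p 5) ^ 2) / (4 * τ)) with hGdef
  set H0 : ℝ := zonal τ s with hH0def
  set H1 : ℝ := deriv (zonal τ) s with hH1def
  set H2 : ℝ := deriv (deriv (zonal τ)) s with hH2def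
  have hsI : s ∈ Icc (-1 : ℝ) 1 := abs_le.1 (abs_sum_mul_le_one hz hp)
  have hG : 0 < G := Real.exp_pos _
  have hH0 : 0 < H0 := zonal_pos hτ s hsI
  have hm : 0 ≤ m := Finset.sum_nonneg fun i _ => sq_nonneg _
  obtain ⟨hR, hT⟩ := zonal_matrixHarnack hτ hsI
  have hCS : α ^ 2 ≤ (1 - s ^ 2) * m := inner_tangent_sq_le hp hz hv
  -- the form in zonal terms
  have hk : cylKernel p τ z = H0 * G := cylKernel_eq p τ z
  have hD1 : fderiv ℝ (cylKernel p τ) z v = (H1 * α - H0 * ((z 5 - p 5) / (2 * τ)) * v 5) * G :=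
    fderiv_cylKernel_apply p hτ z v
  have hDn : fderiv ℝ (cylKernel p τ) z (Literature.Geometry.Manifold.CylinderSlice.padL (truncL z)) =
      H1 * s * G := by
    rw [fderiv_cylKernel_apply p hτ, inner5_padL_truncL, padL_truncL_apply_five]
    ring
  have hD2 : iteratedFDeriv ℝ 2 (cylKernel p τ) z ![v, v] =
      (H2 * α * α - H1 * ((z 5 - p 5) / (2 * τ)) * (v 5 * α + α * v 5) +
        H0 * ((z 5 - p 5) ^ 2 / (4 * τ ^ 2) - 1 / (2 * τ)) * v 5 * v 5) * G :=
    iteratedFDeriv_two_cylKernel_apply p hτ z v v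
  rw [hD2, hDn, hD1, hk, norm_sq_eq_sum_add, ← hmdef]
  -- `Q = (G/H0) · E` with `E = α² (H2 H0 - H1²) + m (-s H1 H0 + H0²/(2τ))`
  have hE : 0 ≤ α ^ 2 * (H2 * H0 - H1 ^ 2) + m * (-s * (H1 * H0) + H0 ^ 2 / (2 * τ)) := by
    rcases le_or_gt 0 (H2 * H0 - H1 ^ 2) with hD | hD
    · nlinarith [mul_nonneg (sq_nonneg α) hD, mul_nonneg hm hT]
    · have h1 : (1 - s ^ 2) * m * (H2 * H0 - H1 ^ 2) ≤ α ^ 2 * (H2 * H0 - H1 ^ 2) :=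
        mul_le_mul_of_nonpos_right hCS hD.le
      nlinarith [mul_nonneg hm hR]
  have hτne : τ ≠ 0 := hτ.ne'
  have hH0ne : H0 ≠ 0 := hH0.ne'
  have hGne : G ≠ 0 := hG.ne'
  have key : (H2 * α * α - H1 * ((z 5 - p 5) / (2 * τ)) * (v 5 * α + α * v 5) +
          H0 * ((z 5 - p 5) ^ 2 / (4 * τ ^ 2) - 1 / (2 * τ)) * v 5 * v 5) * G
        - m * (H1 * s * G)
        - ((H1 * α - H0 * ((z 5 - p 5) / (2 * τ)) * v 5) * G) ^ 2 / (H0 * G)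
        + H0 * G * (m + v 5 ^ 2) / (2 * τ)
      = G / H0 * (α ^ 2 * (H2 * H0 - H1 ^ 2) + m * (-s * (H1 * H0) + H0 ^ 2 / (2 * τ))) := by
    field_simp
    ring
  rw [key]
  exact mul_nonneg (div_nonneg hG.le hH0.le) hE

end Literature.Geometry.Riemannian.SphericalCylinderEntropy

end
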